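import Summits.ABC.IUTFork.Cor312LicenceExactRadiusEnvelope
import Literature.IUT.LogVolume.DHUnitLogCrudeBound
import HarnessLib

/-!
# [IUTchIII] Cor. 3.12 — the ENVELOPE-radius refutation socket in REALISING form: ONE real inequality in
# `(m_q, e, d, a, a₀)` at a place `x₀ | p` refutes the (xi-f) licence / branch C's S_H antecedent at `settingPrVolSharp`

PROOF-ONLY support piece (D-0012; 0 definitions, 0 `Prop` facts) of the abc-iut cell (D-0079 R-W numerics crew seat abc-iut-W-num-6, gen 0;
RECIPE «RAD-UNIFORM», HOME/abc-iut-W-num-6/census/k2/). TAKES NO SIDE on [IUTchIII] Cor. 3.12 (S. Mochizuki, *Inter-universal Teichmüller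
theory III*, kurims manuscript, Cor. 3.12 p. 173 l. 41 – p. 174 l. 19; Step (xi-f) p. 184 l. 26–29) or on any author: every statement is about OUR
typed objects (abc-iut-c312-5's `logShellsDH`, abc-iut-c312-3's sharp idele boxes, the assembled setting `settingPrVolSharp`); the hull-level /
per-packet reading is a STRONGER-THAN-PRINT form; nothing here bears on the printed GLOBAL inequality. typed ≠ proved; refuted-as-typed ≠ refuted-in-print.

WHAT IS PROVED (namespace `Summit.ABC.IUTFork.Thm311.Real`): `not_exists_qPinned_hull_settingPrVolSharp_of_realising_star_envelope` —
abc-iut-c312-3's envelope socket (the licence form follows verbatim from `not_licence_settingPrVolSharp_of_explicitDepth_star_envelope` with the same `hdeep`)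
`…_of_explicitDepth_star_envelope` (p454852: STAR absorption exponent, radius `‖ϖ‖^{p^{a₀} − e·a₀}` of `UnitLogMaxNorm`) with its three norm
hypotheses DISCHARGED from REALISING data at ONE place `x₀ | p` (any prime, any ramification):
`‖t_{q,x₀}‖ = p^{−m_q/e}` (`m_q ∈ ℤ`), `‖t_{Θ,i₀+1,x₀}‖ = ‖t_{q,x₀}‖^{(i₀+1)²}` (Dupuy–Hilado (3.4)), and the single REAL inequality

  `m_q/e + (i₀+2)·(a₀ − p^{a₀}/e) < ⌊(i₀+1)²·m_q/e − (i₀+1)·d − (i₀+2)·a⌋`,  `d = differentOrd`, `a = logRadiusA p e` of `K_{x₀}`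

(the diagonal summand's constants are `(i₀+2)` copies of the per-field ones, `card_caps_labelSucc`; `‖ϖ‖^N = p^{−N/e}`,
`DHCrudeLog.norm_unif_zpow_eq_rpow`). This is exactly the conclusion shape of the R-W numerics core
`Summit.ABC.IUTFork.Conditional.HexRad.logExponent_lt_floor_of_criterion` (p462893, `μ = m_q/e = k/l`), so a datum-level wrapper only has to
produce the realising identities at the place of `Conditional.GenuineK.exists_place_lamSeven`.
HONEST SCOPE: an UPPER BOUND on the hull read at ONE diagonal summand; OUR containers and OUR typed (Ind1)/(Ind2); refuted-as-typed ≠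
refuted-in-print; nothing about the number-level `Cor22.Cor312AtDatum`. [cite: Mochizuki2012, IUTchIV Prop. 1.1 p. 9, Prop. 1.2 (i)(ii) p. 10]
[cite: DupuyHilado2025, §3.4, §3.9, §4.9, §4.12] [cite: ScholzeStix2018, §2.2 pp. 9–10] [cite: NeukirchANT1999, Ch. II (5.5)]
[claim: Mochizuki2012, status: disputed] for every IUT sentence quoted.
-/

noncomputable section

open Set Function
open scoped Pointwise

namespace Summit.ABC.IUTFork.Thm311.Real

open Cor312 Cor312.Setting Cor312Vol Cor312Vol.ExplicitDepth Literature.IUT.LogThetaLattice Literature.IUT.LogVolume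
  Literature.IUT.LogVolume.LogEnvelope Literature.NumberTheory.GaloisRepresentations.Ultrametric NumberField IsDedekindDomain

variable {F : Type} [Field F] [NumberField F] (X : PilotData F) {logv : PadicLogs F} (hlog : LogvAnalytic logv)
  (M : Type) [Field M] [NumberField M]
  (archPk : ∀ (j : (thetaIndex X).Label) (vQ : (thetaIndex X).VQ), Set ((logShellsDH X logv).Packet j vQ))
  (archSub : ∀ (j : (thetaIndex X).Label) (v : (thetaIndex X).V),
    Set ((logShellsDH X logv).Packet j ((thetaIndex X).over v)))
  (Ψ : ℤ → ∀ v : (thetaIndex X).V, v ∈ (thetaIndex X).Vbad → Set ((logShellsDH X logv).StarPacket v))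
  (act : ℤ → ∀ v : (thetaIndex X).V, v ∈ (thetaIndex X).Vbad →
    (logShellsDH X logv).StarPacket v → Module.End ℚ ((logShellsDH X logv).StarPacket v))
  (Mmod : ℤ → ∀ j : (thetaIndex X).LabelStar, Set ((logShellsDH X logv).GlobalPacket j.1))
  (region : ℤ → ∀ j : (thetaIndex X).LabelStar, FinDivisor M → ∀ vQ : (thetaIndex X).VQ,
    Set ((logShellsDH X logv).Packet j.1 vQ))
  (n : ℤ) {HT : Type} {LogLink : HT → HT → Type} {IsFull : ∀ {s t : HT}, LogLink s t → Prop}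
  (lat : LGPGaussianLogThetaLattice LogLink IsFull)
  {Frd : Type} {IsoF : Frd → Frd → Type} {Ob : Frd → Type} {realify : Frd → Frd} {Strip : Type}
  {IsoS : Strip → Strip → Type} {Mv : ∀ v : (thetaIndex X).V, v ∈ (thetaIndex X).Vbad → Type}
  [∀ v h, Monoid (Mv v h)]
  (sig : GlobalLGPFrobenioidSignature (thetaIndex X).lstar (thetaIndex X).V (· ∈ (thetaIndex X).Vbad)
    Frd IsoF Ob realify Strip IsoS Mv)
  (split : SplittingMonoids Mv) {ObΔ : Type} {N : ∀ v : (thetaIndex X).V, v ∈ (thetaIndex X).Vbad → Type}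
  [∀ v h, Monoid (N v h)] (qData : QPilotData ObΔ N)
  (tq : ∀ (pp : Nat.Primes) (x : (thetaIndex X).Fibre (.inr pp)), haveI : Fact (pp : ℕ).Prime := ⟨pp.2⟩; kOf X pp.1 x)
  (t : ∀ (pp : Nat.Primes) (_ : Fin X.lstar) (x : (thetaIndex X).Fibre (.inr pp)),
    haveI : Fact (pp : ℕ).Prime := ⟨pp.2⟩; kOf X pp.1 x)
  (htq0 : ∀ pp x, tq pp x ≠ 0)
  (htq1 : ∀ (pp : Nat.Primes) (x : (thetaIndex X).Fibre (.inr pp)),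
    haveI : Fact (pp : ℕ).Prime := ⟨pp.2⟩; placeOf X pp.1 x ∉ X.S → ‖tq pp x‖ = 1)

/-! ## The envelope socket in realising form -/

/-- **BRANCH C's S_H ANTECEDENT IS UNSATISFIABLE at `settingPrVolSharp` — envelope radius, REALISING form, ONE real inequality.**
At a place `x₀ | p` (any prime, any ramification) with norm uniformizer `ϖ`, turning point `a₀` of `e = e(x₀|p)`, realising ideles
`‖t_{q,x₀}‖ = p^{−m_q/e}`, `‖t_{Θ,i₀+1,x₀}‖ = ‖t_{q,x₀}‖^{(i₀+1)²}`, the inequality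
`m_q/e + (i₀+2)(a₀ − p^{a₀}/e) < ⌊(i₀+1)² m_q/e − (i₀+1) d − (i₀+2) a⌋` (`d`, `a` of `K_{x₀}`) refutes `∃ ρ qK, QPinned ∧ PilotKummerCompatHull`
for every column structure. [cite: Mochizuki2012, IUTchIV Prop. 1.1 p. 9, Prop. 1.2 (i)(ii) p. 10] [cite: DupuyHilado2025, §3.4, §3.9, §4.9]
[cite: NeukirchANT1999, Ch. II (5.5)] [claim: Mochizuki2012, status: disputed] -/
theorem not_exists_qPinned_hull_settingPrVolSharp_of_realising_star_envelope (col : ℤ → Column (logShellsDH X logv))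
    (pp : Nat.Primes) (i₀ : Fin (thetaIndex X).lstar) (x₀ : (thetaIndex X).Fibre (.inr pp)) (mq : ℤ)
    (hq : haveI : Fact (pp : ℕ).Prime := ⟨pp.2⟩
      ‖tq pp x₀‖ = ((pp : ℕ) : ℝ) ^ (-((mq : ℝ) / absRamificationIdx (pp : ℕ) (kOf X pp.1 x₀))))
    (hΘq : haveI : Fact (pp : ℕ).Prime := ⟨pp.2⟩
      ‖t pp i₀ x₀‖ = ‖tq pp x₀‖ ^ ((((i₀ : ℕ) + 1 : ℕ) : ℝ) ^ 2))
    (ϖ : haveI : Fact (pp : ℕ).Prime := ⟨pp.2⟩; (kOf X pp.1 x₀)ˣ)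
    (hϖ : haveI : Fact (pp : ℕ).Prime := ⟨pp.2⟩; IsUniformizer ϖ) (a₀ : ℕ)
    (hlo : haveI : Fact (pp : ℕ).Prime := ⟨pp.2⟩
      ∀ a < a₀, ((pp : ℕ) : ℤ) ^ a * (((pp : ℕ) : ℤ) - 1) < absRamificationIdx (pp : ℕ) (kOf X pp.1 x₀))
    (hhi : haveI : Fact (pp : ℕ).Prime := ⟨pp.2⟩
      (absRamificationIdx (pp : ℕ) (kOf X pp.1 x₀) : ℤ) ≤ ((pp : ℕ) : ℤ) ^ a₀ * (((pp : ℕ) : ℤ) - 1))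
    (hineq : haveI : Fact (pp : ℕ).Prime := ⟨pp.2⟩
      (mq : ℝ) / absRamificationIdx (pp : ℕ) (kOf X pp.1 x₀)
          + ((i₀ : ℕ) + 2 : ℝ) * ((a₀ : ℝ) - ((pp : ℕ) : ℝ) ^ a₀ / absRamificationIdx (pp : ℕ) (kOf X pp.1 x₀)) <
        ⌊(((i₀ : ℕ) + 1 : ℝ)) ^ 2 * mq / absRamificationIdx (pp : ℕ) (kOf X pp.1 x₀)
            - ((i₀ : ℕ) + 1 : ℝ) * differentOrd (pp : ℕ) (kOf X pp.1 x₀)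
            - ((i₀ : ℕ) + 2 : ℝ) * logRadiusA (pp : ℕ) (absRamificationIdx (pp : ℕ) (kOf X pp.1 x₀))⌋) :
    ¬ ∃ (ρ : (∀ v : (thetaIndex X).V, v ∈ (thetaIndex X).Vbad → Set ((logShellsDH X logv).StarPacket v)) →
          ∀ (j : (thetaIndex X).Label) (vQ : (thetaIndex X).VQ), Set ((logShellsDH X logv).Packet j vQ))
        (qK : ∀ v : (thetaIndex X).V, v ∈ (thetaIndex X).Vbad → Set ((logShellsDH X logv).StarPacket v)),
        QPinned ({ toSituation := situationPrVol X hlog M archPk archSub Ψ act Mmod region, col := col } :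
            LatticeSituation (thetaIndex X))
          (settingPrVolSharp X hlog M archPk archSub Ψ act Mmod region n lat sig split qData tq t htq0 htq1) ρ qK ∧
        PilotKummerCompatHull ({ toSituation := situationPrVol X hlog M archPk archSub Ψ act Mmod region, col := col } :
            LatticeSituation (thetaIndex X))
          (settingPrVolSharp X hlog M archPk archSub Ψ act Mmod region n lat sig split qData tq t htq0 htq1) ρ qK := by
  haveI : Fact (pp : ℕ).Prime := ⟨pp.2⟩
  have hp0 : (0 : ℝ) < ((pp : ℕ) : ℝ) := by exact_mod_cast pp.2.pos
  have hp1 : (1 : ℝ) < ((pp : ℕ) : ℝ) := by exact_mod_cast pp.2.one_lt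
  set ee : ℝ := (absRamificationIdx (pp : ℕ) (kOf X pp.1 x₀) : ℝ) with hee
  have he0 : 0 < ee := by rw [hee]; exact_mod_cast absRamificationIdx_pos (pp : ℕ) (kOf X pp.1 x₀)
  set k₀ := (presAt X hlog pp).kk (fun _ : (thetaIndex X).Caps (labelSucc i₀) => x₀) with hk₀
  set mΘ : ℤ := (((i₀ : ℕ) + 1) ^ 2 : ℕ) * mq with hmΘ
  -- the Θ-norm in exponent form
  have hΘ : ‖t pp i₀ x₀‖ = ((pp : ℕ) : ℝ) ^ (-((mΘ : ℝ) / absRamificationIdx (pp : ℕ) (kOf X pp.1 x₀))) := by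
    rw [hΘq, hq, ← Real.rpow_mul hp0.le]
    congr 1
    rw [hmΘ]
    push_cast
    ring
  -- the diagonal summand's constants are `(i₀+2)` copies of the per-field ones
  have hcard := card_caps_labelSucc X i₀
  set D : ℝ := differentOrd (pp : ℕ) (kOf X pp.1 x₀) with hD
  set A : ℝ := logRadiusA (pp : ℕ) (absRamificationIdx (pp : ℕ) (kOf X pp.1 x₀)) with hA
  have hds : dSum (pp : ℕ) k₀ = ((i₀ : ℕ) + 2 : ℝ) * D := by
    have h1 : dSum (pp : ℕ) k₀ = ∑ _a : (thetaIndex X).Caps (labelSucc i₀), D := Finset.sum_congr rfl fun _ _ => rfl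
    rw [h1, Finset.sum_const, Finset.card_univ, hcard]
    simp only [nsmul_eq_mul]
    push_cast
    ring
  have has : aSum (pp : ℕ) k₀ = ((i₀ : ℕ) + 2 : ℝ) * A := by
    have h1 : aSum (pp : ℕ) k₀ = ∑ _a : (thetaIndex X).Caps (labelSucc i₀), A := Finset.sum_congr rfl fun _ _ => rfl
    rw [h1, Finset.sum_const, Finset.card_univ, hcard]
    simp only [nsmul_eq_mul]
    push_cast
    ring
  -- the star floor exponent is the one of `hineq`
  have hfloor : ⌊(mΘ : ℝ) / absRamificationIdx (pp : ℕ) (kOf X pp.1 x₀)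
        - (dSum (pp : ℕ) k₀ - differentOrd (pp : ℕ) (kOf X pp.1 x₀)) - aSum (pp : ℕ) k₀⌋
      = ⌊(((i₀ : ℕ) + 1 : ℝ)) ^ 2 * mq / absRamificationIdx (pp : ℕ) (kOf X pp.1 x₀)
          - ((i₀ : ℕ) + 1 : ℝ) * differentOrd (pp : ℕ) (kOf X pp.1 x₀)
          - ((i₀ : ℕ) + 2 : ℝ) * logRadiusA (pp : ℕ) (absRamificationIdx (pp : ℕ) (kOf X pp.1 x₀))⌋ := by
    congr 1
    rw [hds, has, ← hD, ← hA, hmΘ]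
    push_cast
    ring
  set n₁ : ℤ := ⌊(mΘ : ℝ) / absRamificationIdx (pp : ℕ) (kOf X pp.1 x₀)
        - (dSum (pp : ℕ) k₀ - differentOrd (pp : ℕ) (kOf X pp.1 x₀)) - aSum (pp : ℕ) k₀⌋ with hn₁
  -- the three factors as powers of `p`
  have hnp : ‖((pp : ℕ) : ℚ_[pp]) ^ n₁‖ = ((pp : ℕ) : ℝ) ^ ((-n₁ : ℤ) : ℝ) := by
    rw [norm_zpow, Padic.norm_p, inv_zpow', Real.rpow_intCast]
  set β : ℤ := ((pp : ℕ) : ℤ) ^ a₀ - (absRamificationIdx (pp : ℕ) (kOf X pp.1 x₀) : ℤ) * (a₀ : ℤ) with hβ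
  have hϖβ : ‖(ϖ : kOf X pp.1 x₀)‖ ^ β = ((pp : ℕ) : ℝ) ^ (-((β : ℝ) / absRamificationIdx (pp : ℕ) (kOf X pp.1 x₀))) :=
    DHCrudeLog.norm_unif_zpow_eq_rpow (pp : ℕ) hϖ β
  have hrad : (‖(ϖ : kOf X pp.1 x₀)‖ ^ β) ^ ((i₀ : ℕ) + 2)
      = ((pp : ℕ) : ℝ) ^ (-((β : ℝ) / absRamificationIdx (pp : ℕ) (kOf X pp.1 x₀)) * (((i₀ : ℕ) + 2 : ℕ) : ℝ)) := by
    rw [hϖβ, ← Real.rpow_natCast, ← Real.rpow_mul hp0.le]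
  -- `-(β/e) = a₀ - p^{a₀}/e`
  have hβe : -((β : ℝ) / ee) = (a₀ : ℝ) - ((pp : ℕ) : ℝ) ^ a₀ / ee := by
    rw [hβ]
    push_cast
    field_simp
    ring
  -- the real inequality, in `n₁` form
  have hineq' : (mq : ℝ) / ee + ((i₀ : ℕ) + 2 : ℝ) * ((a₀ : ℝ) - ((pp : ℕ) : ℝ) ^ a₀ / ee) < (n₁ : ℝ) := by
    have h := hineq
    rw [← hfloor] at h
    exact h
  have hdeep : ‖((pp : ℕ) : ℚ_[pp]) ^ n₁‖ * (‖(ϖ : kOf X pp.1 x₀)‖ ^ β) ^ ((i₀ : ℕ) + 2) < ‖tq pp x₀‖ := by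
    rw [hnp, hrad, ← Real.rpow_add hp0, hq, Real.rpow_lt_rpow_left_iff hp1]
    have hexp : ((-n₁ : ℤ) : ℝ) + -((β : ℝ) / absRamificationIdx (pp : ℕ) (kOf X pp.1 x₀)) * (((i₀ : ℕ) + 2 : ℕ) : ℝ)
        = -(n₁ : ℝ) + ((i₀ : ℕ) + 2 : ℝ) * ((a₀ : ℝ) - ((pp : ℕ) : ℝ) ^ a₀ / ee) := by
      rw [← hβe, hee]
      push_cast
      ring
    rw [hexp]
    have : -((mq : ℝ) / absRamificationIdx (pp : ℕ) (kOf X pp.1 x₀)) = -((mq : ℝ) / ee) := by rw [hee]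
    rw [this]
    linarith
  exact not_exists_qPinned_hull_settingPrVolSharp_of_explicitDepth_star_envelope X hlog M archPk archSub Ψ act Mmod region n lat sig
    split qData tq t htq0 htq1 col pp i₀ x₀ mΘ hΘ ϖ hϖ a₀ hlo hhi hdeep

end Summit.ABC.IUTFork.Thm311.Real

end
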